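import Summits.ValiantsHypothesis.ValiantsHypothesis.Theorems.FeketeSOSFeketeSOSHardPaleyRIPSpreadL2
import Summits.ValiantsHypothesis.ValiantsHypothesis.Theorems.FeketeSOSFeketeSOSHardPaleyRIPAffine

/-!
# Route FeketeSOS — crux `FeketeSOSHard` (stmt-ValiantsHypothesis-3996), line `paley-rip` v3,
# `stub_tameOperator` on INTERVALS and on arithmetic progressions mod `p` of any difference: EXPONENT 1/2
# at every rank (mass `≤ √(2m(1 + ln m)) · M`)

First concrete instance of the kernel P3′ theorem `tameOperator_spread_l2_sup` (`…PaleyRIPSpreadL2.lean`): on an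
interval `S = [x, x+m)` without wrap-around (`2(x+m) ≤ p+1`) the cyclic representation function is
`r_S(2x+f) = min(f+1, 2m−1−f)`, so `ν_p(S) = Σ_f 1/r_S ≤ 2 H_m ≤ 2(1 + ln m)` (`harmonic_le_one_add_log`), and every
family of weighted squares supported in `S`, of any rank, whose cyclic pattern has coefficients of modulus `≤ M`, is
re-represented on `S` with mass `≤ √(2m(1 + ln m)) · M` (`tameOperator_interval`) — exponent `1/2`, where ℓ¹-spreading
(`tameOperator_spread`, small doubling) gives `(2m−1)·M`.  (Sharp up to the logarithm for flat patterns: random signs;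
cf. `…PaleyRIPIntervalFlatLower.lean`.)  By affine invariance (`tameOperator_affine_transfer`, `…PaleyRIPAffine.lean`)
the same bound holds on every ARITHMETIC PROGRESSION mod `p` of length `m ≤ (p+1)/2`, of any common difference,
wrap-around allowed (`tameOperator_progression`).

Tools: `card_fibre_interval_ge` (the fibre of `2x+f` in `[x,x+m)²` has `≥ min(f+1, 2m−1−f)` elements),
`sum_inv_min_le` (`Σ_{f<2m−1} 1/min(f+1,2m−1−f) ≤ 2(1 + ln m)`), `nu_interval_le`.

Honest framing (rung currency): a Theorems-side helper `--supports` stmt-3996; nothing here closes a registered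
stub; `stub_tameOperator` (all supports), the engine and the crux stay OPEN; `VP ≠ VNP` is untouched.
-/

set_option linter.dupNamespace false

namespace Summit.ValiantsHypothesis.ValiantsHypothesis.Theorems.FeketeSOSHardPaleyRIP

open Polynomial Finset
open scoped BigOperators

noncomputable section

/-! ## Representation function of an interval -/

/-- The fibre of `2x + f` (`f ≤ 2m−2`) in `[x, x+m)²` under `(s,t) ↦ (s+t) mod p` (no wrap-around) has at least
`min(f+1, 2m−1−f)` elements: the pairs `(x+i, x+f−i)`. [folklore] -/
theorem card_fibre_interval_ge (p x m f : ℕ) (hxp : 2 * (x + m) ≤ p + 1) (hf : f < 2 * m - 1) :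
    min (f + 1) (2 * m - 1 - f) ≤
      ((Ico x (x + m) ×ˢ Ico x (x + m)).filter (fun st : ℕ × ℕ => (st.1 + st.2) % p = 2 * x + f)).card := by
  classical
  -- the injection `i ↦ (x+i, x+f−i)` from `[lo, hi]`
  obtain ⟨lo, hi, hcount, hhi, hlo⟩ : ∃ lo hi : ℕ, min (f + 1) (2 * m - 1 - f) = hi + 1 - lo ∧ hi < m ∧
      (∀ i, lo ≤ i → f - i < m ∧ i ≤ f ∨ hi < i) := by
    rcases le_or_gt f (m - 1) with h | h
    · refine ⟨0, f, ?_, by omega, fun i _ => ?_⟩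
      · rw [min_eq_left (by omega)]; omega
      · by_cases hi : i ≤ f
        · left; omega
        · right; omega
    · refine ⟨f - (m - 1), m - 1, ?_, by omega, fun i hi => ?_⟩
      · rw [min_eq_right (by omega)]; omega
      · by_cases hi' : i ≤ m - 1
        · left; omega
        · right; omega
  rw [hcount, ← Nat.card_Icc lo hi]
  refine Finset.card_le_card_of_injOn (fun i => (x + i, x + f - i)) (fun i hi' => ?_)
    (fun i hi' j hj' h => ?_)
  · rw [Finset.mem_coe, Finset.mem_Icc] at hi'
    have h1 : f - i < m ∧ i ≤ f := by
      rcases hlo i hi'.1 with h | h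
      · exact h
      · omega
    rw [Finset.mem_coe]
    show (x + i, x + f - i) ∈ _
    rw [Finset.mem_filter, Finset.mem_product, Finset.mem_Ico, Finset.mem_Ico]
    refine ⟨⟨⟨by omega, by omega⟩, by omega, by omega⟩, ?_⟩
    show (x + i + (x + f - i)) % p = 2 * x + f
    rw [show x + i + (x + f - i) = 2 * x + f by omega]
    exact Nat.mod_eq_of_lt (by omega)
  · have h' : (x + i, x + f - i) = (x + j, x + f - j) := h
    simp only [Prod.mk.injEq] at h'
    omega

/-- `Σ_{f<2m−1} 1/min(f+1, 2m−1−f) ≤ 2 (1 + ln m)` (two harmonic sums). [folklore] -/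
theorem sum_inv_min_le (m : ℕ) (hm : 1 ≤ m) :
    (∑ f ∈ range (2 * m - 1), (1 : ℝ) / (min (f + 1) (2 * m - 1 - f) : ℕ)) ≤ 2 * (1 + Real.log m) := by
  have hH : (∑ i ∈ range m, (1 : ℝ) / ((i + 1 : ℕ) : ℝ)) ≤ 1 + Real.log m := by
    have h := harmonic_le_one_add_log m
    have hcast : ((harmonic m : ℚ) : ℝ) = ∑ i ∈ range m, (1 : ℝ) / ((i + 1 : ℕ) : ℝ) := by
      simp only [harmonic, Rat.cast_sum, Rat.cast_inv, Rat.cast_natCast, one_div]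
    rw [hcast] at h
    exact h
  -- split the range at `m`
  have hsplit : range (2 * m - 1) = range m ∪ (range (2 * m - 1)).filter (fun f => m ≤ f) := by
    ext f
    simp only [Finset.mem_union, Finset.mem_range, Finset.mem_filter]
    omega
  have hdisj : Disjoint (range m) ((range (2 * m - 1)).filter (fun f => m ≤ f)) := by
    rw [Finset.disjoint_left]
    intro f hf hf'
    rw [Finset.mem_range] at hf
    rw [Finset.mem_filter] at hf'
    omega
  rw [hsplit, Finset.sum_union hdisj]
  have h1 : (∑ f ∈ range m, (1 : ℝ) / (min (f + 1) (2 * m - 1 - f) : ℕ)) ≤ 1 + Real.log m := by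
    refine le_trans (Finset.sum_le_sum fun f hf => ?_) hH
    rw [Finset.mem_range] at hf
    rw [min_eq_left (by omega)]
  have h2 : (∑ f ∈ (range (2 * m - 1)).filter (fun f => m ≤ f), (1 : ℝ) / (min (f + 1) (2 * m - 1 - f) : ℕ)) ≤
      1 + Real.log m := by
    -- reindex `f = 2m−2−i`, `i < m−1`
    have hre : (∑ f ∈ (range (2 * m - 1)).filter (fun f => m ≤ f), (1 : ℝ) / (min (f + 1) (2 * m - 1 - f) : ℕ)) =
        ∑ i ∈ range (m - 1), (1 : ℝ) / ((i + 1 : ℕ) : ℝ) := by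
      refine Finset.sum_nbij' (fun f => 2 * m - 2 - f) (fun i => 2 * m - 2 - i) ?_ ?_ ?_ ?_ ?_
      · intro f hf
        rw [Finset.mem_filter, Finset.mem_range] at hf
        rw [Finset.mem_range]; omega
      · intro i hi
        rw [Finset.mem_range] at hi
        rw [Finset.mem_filter, Finset.mem_range]; omega
      · intro f hf
        rw [Finset.mem_filter, Finset.mem_range] at hf
        omega
      · intro i hi
        rw [Finset.mem_range] at hi
        omega
      · intro f hf
        rw [Finset.mem_filter, Finset.mem_range] at hf
        rw [min_eq_right (by omega)]
        congr 2
        omega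
    rw [hre]
    refine le_trans ?_ hH
    have hsub : range (m - 1) ⊆ range m := Finset.range_mono (Nat.sub_le m 1)
    exact Finset.sum_le_sum_of_subset_of_nonneg hsub fun i _ _ => by positivity
  linarith

section Interval

variable (p : ℕ) [Fact p.Prime]

omit [Fact p.Prime] in
/-- `ν_p([x, x+m)) ≤ 2(1 + ln m)` when `2(x+m) ≤ p+1` (no wrap-around). [folklore] -/
theorem nu_interval_le (x m : ℕ) (hm : 1 ≤ m) (hxp : 2 * (x + m) ≤ p + 1) :
    (∑ ν ∈ (Ico x (x + m) ×ˢ Ico x (x + m)).image (fun st : ℕ × ℕ => (st.1 + st.2) % p),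
      (1 : ℝ) / (((Ico x (x + m) ×ˢ Ico x (x + m)).filter
        (fun st : ℕ × ℕ => (st.1 + st.2) % p = ν)).card : ℝ)) ≤ 2 * (1 + Real.log m) := by
  classical
  -- the cyclic sumset is `{2x + f : f < 2m−1}`
  have himg : (Ico x (x + m) ×ˢ Ico x (x + m)).image (fun st : ℕ × ℕ => (st.1 + st.2) % p) ⊆
      (range (2 * m - 1)).image (fun f => 2 * x + f) := by
    intro ν hν
    obtain ⟨st, hst, rfl⟩ := Finset.mem_image.1 hν
    rw [Finset.mem_product, Finset.mem_Ico, Finset.mem_Ico] at hst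
    refine Finset.mem_image.2 ⟨st.1 + st.2 - 2 * x, mem_range.2 (by omega), ?_⟩
    rw [Nat.mod_eq_of_lt (by omega)]
    omega
  refine le_trans (Finset.sum_le_sum_of_subset_of_nonneg himg fun ν _ _ => by positivity) ?_
  rw [Finset.sum_image fun f _ g _ h => by omega]
  refine le_trans (Finset.sum_le_sum fun f hf => ?_) (sum_inv_min_le m hm)
  have hf' := mem_range.1 hf
  have hmin : 0 < min (f + 1) (2 * m - 1 - f) := by
    apply lt_min <;> omega
  exact one_div_le_one_div_of_le (by exact_mod_cast hmin)
    (by exact_mod_cast card_fibre_interval_ge p x m f hxp hf')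

/-- **`stub_tameOperator` on intervals: exponent `1/2` at every rank.**  If `S = [x, x+m)` with `2(x+m) ≤ p+1`
and weighted squares supported in `S` (any number) have cyclic pattern `F` (`deg F < p`) with `|F_n| ≤ M`, then
there are weighted squares supported in `S` with the same cyclic pattern and mass `≤ √(2m(1 + ln m)) · M`.
[folklore] -/
theorem tameOperator_interval (x m : ℕ) (hm : 1 ≤ m) (hxp : 2 * (x + m) ≤ p + 1)
    (r : ℕ) (c : Fin r → ℂ) (w : Fin r → ℂ[X]) (hw : ∀ i, (w i).support ⊆ Ico x (x + m))
    (F : ℂ[X]) (M : ℝ) (hF : F.natDegree < p)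
    (hdvd : (X : ℂ[X]) ^ p - 1 ∣ (∑ i, C (c i) * w i ^ 2) - F) (hM : ∀ n, ‖F.coeff n‖ ≤ M) :
    ∃ (s' : ℕ) (c' : Fin s' → ℂ) (w' : Fin s' → ℂ[X]), (∀ j, (w' j).support ⊆ Ico x (x + m)) ∧
      ((X : ℂ[X]) ^ p - 1 ∣ (∑ j, C (c' j) * w' j ^ 2) - F) ∧
      (∑ j, sqMass (c' j) (w' j)) ≤ Real.sqrt (2 * m * (1 + Real.log m)) * M := by
  classical
  have hM0 : 0 ≤ M := (norm_nonneg _).trans (hM 0)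
  obtain ⟨s', c', w', h1, h2, h3⟩ := tameOperator_spread_l2_sup p (Ico x (x + m)) r c w hw F M hF hdvd hM
  refine ⟨s', c', w', h1, h2, h3.trans (mul_le_mul_of_nonneg_right (Real.sqrt_le_sqrt ?_) hM0)⟩
  rw [Nat.card_Ico, show x + m - x = m by omega]
  have h := mul_le_mul_of_nonneg_left (nu_interval_le p x m hm hxp) (Nat.cast_nonneg m)
  linarith

/-- **`stub_tameOperator` on arithmetic progressions mod `p` of any common difference: exponent `1/2` at every
rank.**  If `S ⊆ [0,p)` is mapped by some affine map `s ↦ (a s + b) mod p` (`p ∤ a`) onto an interval `[x, x+m)`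
with `2(x+m) ≤ p+1` — i.e. `S` is an arithmetic progression of length `m ≤ (p+1)/2` in `ℤ/p`, wrap-around
allowed — then every family of weighted squares supported in `S` whose cyclic pattern has coefficients of modulus
`≤ M` is re-represented on `S` with mass `≤ √(2m(1 + ln m)) · M`. [folklore] -/
theorem tameOperator_progression (a b : ℕ) (ha : ¬ p ∣ a) (S : Finset ℕ) (hS : ∀ s ∈ S, s < p) (x m : ℕ)
    (hm : 1 ≤ m) (hxp : 2 * (x + m) ≤ p + 1) (hSimg : S.image (fun s => (a * s + b) % p) = Ico x (x + m))
    (r : ℕ) (c : Fin r → ℂ) (w : Fin r → ℂ[X]) (hw : ∀ i, (w i).support ⊆ S)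
    (F : ℂ[X]) (M : ℝ) (hF : F.natDegree < p)
    (hdvd : (X : ℂ[X]) ^ p - 1 ∣ (∑ i, C (c i) * w i ^ 2) - F) (hM : ∀ n, ‖F.coeff n‖ ≤ M) :
    ∃ (s' : ℕ) (c' : Fin s' → ℂ) (w' : Fin s' → ℂ[X]), (∀ j, (w' j).support ⊆ S) ∧
      ((X : ℂ[X]) ^ p - 1 ∣ (∑ j, C (c' j) * w' j ^ 2) - F) ∧
      (∑ j, sqMass (c' j) (w' j)) ≤ Real.sqrt (2 * m * (1 + Real.log m)) * M := by
  refine tameOperator_affine_transfer p a b ha S hS r (Real.sqrt (2 * m * (1 + Real.log m)))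
    (fun c w hw F M hF hdvd hM => ?_) c w hw F M hF hdvd hM
  rw [hSimg] at hw ⊢
  exact tameOperator_interval p x m hm hxp r c w hw F M hF hdvd hM

end Interval

end

end Summit.ValiantsHypothesis.ValiantsHypothesis.Theorems.FeketeSOSHardPaleyRIP
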